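import Summits.BirchSwinnertonDyer.BirchSwinnertonDyer.Theorems.UniversalToricDescentBDPFrameCrossPeriodRigidity
import Summits.BirchSwinnertonDyer.BirchSwinnertonDyer.Theorems.UniversalToricDescentTwinSplitIMCAtThreeSupsetGoodOrd
import Literature.NumberTheory.EllipticCurves.YanZhu2026.AnticyclotomicMainTheorems
import HarnessLib

/-!
# Route `UniversalToricDescent`, crux #3 `TwinSplitIMCAtThree` (item stmt-BirchSwinnertonDyer-20214):
# BOTH conjuncts, at EVERY frame, for a GOOD-ORDINARY twin at `p = 3` whose `3`-adic representation has
# full image over `K` — by name Yan–Zhu 2026 Thm. 5.7 (1) (J. Algebra 693, printed for odd `p`) composed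
# with the tree's integral cross-period rigidity; and the RATIONAL equality at every frame without the
# full-image hypothesis

Seat `bsd-wall-utd-p2` (D-0131 (3) MIDDLE tier; memo `HOME/bsd-wall/bsd-wall-utd-p2/SUPSET-AT3-v2.md` §5).
Kernel-checked, sorry-free, CONDITIONAL on ONE named refereed fact taken as a hypothesis: `h57` =
`Literature.NumberTheory.EllipticCurves.YanZhu2026.thm57_isTorsion_charIdealXGr_eq_bdpLFunction`
(X. Yan, X. Zhu, J. Algebra 693 (2026) 372–402, Thm. 5.7 (1), typed by cell `bsd-littype` at `3 ≤ p`
verbatim from the journal text: "`p > 2` … good ordinary", `K` imaginary quadratic with `p` split and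
the Heegner hypothesis, `ρ̄_E|_{G_K}` irreducible, §3.5's `D_K` odd `≠ −3`; conclusion: a BDP frame with
`𝒳_{𝓕_Gr}` `Λ`-torsion, `Char·Λ^{ur} ⊗ ℚ = (𝓛)` RATIONALLY, and INTEGRALLY if `ρ_E|_{G_K} : G_K →
Aut_{ℤ_p}(T_pE)` is surjective; provenance flag of the typer `YZ26@3-BF-ERL-Ohta` on the proof-level
inputs at `p = 3` — informational, the fact is typed as printed).

* `exists_frame_charIdeal_eq_of_goodOrd_of_fullImage` — twin `W′` good ORDINARY at `3`, `ρ̄_{W′,3}` onto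
  over `ℚ`, FULL `3`-adic image over `K` (every `ℤ_3`-automorphism of `T_3(W′_K)` is a Galois element —
  verbatim the binder of the fact and of the tree's `HowardHypotheses.surjective`), `K` imaginary
  quadratic with the Heegner hypothesis for `N′` and `D_K` odd (`D_K ≠ −3` is automatic from `3` split),
  `κ` anticyclotomic, `3 = 𝔭𝔭′`, `ι′` inducing `𝔭`: a frame `(Ω_K ≠ 0, Ω_p ∈ R₀ˣ, L′)` with `X_ac(W′_K)`
  strict at `𝔭′` `Λ`-torsion and `Ch_Λ(X_ac)·R₀⟦T⟧ = (L′)` along `toUnr 3`.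
* `twinSplit_instance_of_goodOrd_of_fullImage` — conjuncts (i) ∧ (ii) of `TwinSplitIMCAtThree` VERBATIM
  at `(W′, N′, K, Dt′, κ, γ, 𝔭, 𝔭′, ι′)`: the `∀`-frame identity from the `∃`-frame one by
  `forall_frame_eq_span_of_exists` (integral cross-period rigidity, p536114).
* `forall_frame_charIdeal_eq_rat_of_goodOrd` — WITHOUT the full-image hypothesis: at EVERY frame
  `(Ω_K ≠ 0, Ω_p ≠ 0, L′)`, `3^k · L′ ∈ Ch·R₀⟦T⟧` and `3^{k′} · Ch·R₀⟦T⟧ ⊆ (L′)` for some `k, k′` — the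
  crux's clause (ii) RATIONALLY (in `Λ^{ur} ⊗ ℚ_3`) on every good-ordinary twin with `D_K` odd.

PARTITION (census TWIN-PRINT-AT3-v1): bucket A = 745 of the 2 023 twin classes have a good-ordinary
twin; on A, crux #3 is now BY NAME a published theorem up to (a) the choice of a twin with full `3`-adic
image over `K` (index-`1` `3`-adic image over `ℚ`, `K ≠ ℚ(√−3)` automatic — censusable on the DB twins'
adelic-image labels; genus-`0` twin families make such twins abundant, not proved here) and (b) `D_K`
odd (free: demand `2 ∣ M` in Friedberg–Hoffstein). Buckets B (675) and C (603): untouched. Beyond-print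
BSD theorem: NO (Yan–Zhu's own odd-`p` statement, wired). `--supports stmt-BirchSwinnertonDyer-20214`.

References: [YanZhu2024MainConjNonCM] Thm. 5.7 (1) (arXiv:2412.20078v4 l.1217–1227; J. Algebra 693);
[Castella2018] Thm. 3.1; [BurungaleCastellaKim2021] Thm. 5.2 ("Arguing as in", Yan–Zhu Thm. 5.9).
-/

noncomputable section

open scoped Classical Topology

set_option linter.dupNamespace false
set_option autoImplicit false

namespace Summit.BirchSwinnertonDyer.BirchSwinnertonDyer.Theorems.UniversalToricDescentTwinSplit

open Filter PowerSeries WeierstrassCurve NumberField IsDedekindDomain Field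
  Literature.NumberTheory.EllipticCurves
  Literature.NumberTheory.EllipticCurves.ModularForms
  Literature.NumberTheory.EllipticCurves.Rank1Residual
  Literature.NumberTheory.GaloisRepresentations
  Summit.BirchSwinnertonDyer.Rank1Residual
  Summit.BirchSwinnertonDyer.Rank1Residual.X11b
  Summit.BirchSwinnertonDyer.Rank1Residual.X11b.Halves
  Summit.BirchSwinnertonDyer.BirchSwinnertonDyer.Theorems.SchneiderFree

/-- **Crux #3's characteristic-ideal identity at ONE frame, for a good-ordinary twin with full `3`-adic
image over `K`** (Yan–Zhu 2026 Thm. 5.7 (1), integral clause, at `p = 3`), in the crux's currency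
(Summits-side `X_ac`, structure map `toUnr 3`). CONDITIONAL on the named fact `h57`.
[cite: YanZhu2024MainConjNonCM, Thm. 5.7 (1) (§5.2, arXiv:2412.20078v4 l.1217–1227; J. Algebra 693 (2026))] -/
theorem exists_frame_charIdeal_eq_of_goodOrd_of_fullImage
    (h57 : YanZhu2026.thm57_isTorsion_charIdealXGr_eq_bdpLFunction)
    (W' : WeierstrassCurve ℚ) [W'.IsElliptic] [W'.IsGloballyMinimal] (N' : ℕ) [NeZero N']
    (K : Type) [Field K] [NumberField K] (Dt' : ModularParametrizationData W' N')
    (hord : GoodOrd W' 3) (hsurj : W'.HasSurjectiveModNGaloisRep 3)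
    (hfull : ∀ u : Module.End ℤ_[3] ((W'.baseChange K).tateModule 3), IsUnit u →
      u ∈ Set.range (galoisRepTate (W'.baseChange K) 3))
    (hK : IsImaginaryQuadratic K) (hH : SatisfiesHeegnerHypothesis N' K)
    (hodd : Odd (NumberField.discr K))
    (κ : ZpExtension K 3) (hκ : κ.IsAnticyclotomic) (γ : absoluteGaloisGroup K)
    [Fact (κ.IsTopGenerator γ)]
    (𝔭 : HeightOneSpectrum (𝓞 K)) (h𝔭 : ((3 : ℕ) : 𝓞 K) ∈ 𝔭.asIdeal)
    (he : 𝔭.asIdeal.ramificationIdx (𝓞 ℚ) = 1) (hf : 𝔭.asIdeal.inertiaDeg (𝓞 ℚ) = 1)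
    (𝔭' : HeightOneSpectrum (𝓞 K)) (h𝔭' : ((3 : ℕ) : 𝓞 K) ∈ 𝔭'.asIdeal) (hne : 𝔭' ≠ 𝔭)
    (ι' : PadicAlgCl 3 ≃+* ℂ) (hι' : BranchInducesPrime 3 ι' 𝔭) :
    ∃ (ΩK : ℂ) (Ωp : (unrIntegers 3)ˣ) (L' : UnrSeries 3),
      ΩK ≠ 0 ∧ IsBDPLFunction ι' 𝔭 κ γ Dt'.f ΩK ((Ωp : unrIntegers 3) : ℂ_[3]) L' ∧
      Module.IsTorsion (IwasawaAlgebra 3) (AcSelmer.XAc (W'.baseChange K) 3 κ 𝔭' ∅ γ) ∧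
      (AcSelmer.XAc.charIdeal (W'.baseChange K) 3 κ 𝔭' ∅ γ).map (PowerSeries.map (toUnr 3)) =
        Ideal.span {L'} := by
  have h2 : Module.finrank ℚ K = 2 := hK.1
  have hspl : ((Ideal.span {((3 : ℕ) : ℤ)}).primesOver (𝓞 K)).ncard = 2 :=
    ncard_primesOver_eq_two_of_degreeOne h2 h𝔭 he hf
  have hirrK : (W'.baseChange K).HasIrreducibleModPGaloisRep 3 := irrK_of_surj W' 3 hsurj K h2
  have hd3 : NumberField.discr K ≠ -3 := by
    have hnd : ¬ ((3 : ℕ) : ℤ) ∣ NumberField.discr K :=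
      not_dvd_discr_of_ncard_primesOver Nat.prime_three (hspl.trans h2.symm)
    intro h
    exact hnd ⟨-1, by rw [h]; norm_num⟩
  obtain ⟨ΩK, Ωp, L, hΩK, hL, htors, hdiv⟩ :=
    h57 ι' W' K 𝔭 𝔭' κ γ Dt'.isNewformOf le_rfl hord hirrK hK hH hspl hodd hd3 hι' h𝔭' hne hκ
  refine ⟨ΩK, Ωp, L, hΩK, hL, htors, ?_⟩
  have heq := (hdiv (toUnr 3) (coe_toUnr 3)).2 hfull
  rw [xac_charIdeal_eq_literature (W'.baseChange K) 3 κ 𝔭' ∅ γ]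
  exact heq

/-- **Crux #3 `TwinSplitIMCAtThree` holds — conjuncts (i) ∧ (ii) VERBATIM, at EVERY frame — at every
instance whose twin is good ordinary at `3` with `ρ̄₃` onto over `ℚ` and full `3`-adic image over `K`,
and whose `K` has `D_K` odd.** (ii) at every frame from the one frame of Yan–Zhu 5.7 (1) by the integral
cross-period rigidity `forall_frame_eq_span_of_exists`. CONDITIONAL on the named fact `h57`.
[cite: YanZhu2024MainConjNonCM, Thm. 5.7 (1) (§5.2, arXiv:2412.20078v4 l.1217–1227; J. Algebra 693 (2026))]
[cite: Castella2018, Thm. 3.1 (arXiv:1704.06608 p. 9) (the interpolation property pinning each frame)] -/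
theorem twinSplit_instance_of_goodOrd_of_fullImage
    (h57 : YanZhu2026.thm57_isTorsion_charIdealXGr_eq_bdpLFunction)
    (W' : WeierstrassCurve ℚ) [W'.IsElliptic] [W'.IsGloballyMinimal] (N' : ℕ) [NeZero N']
    (K : Type) [Field K] [NumberField K] (Dt' : ModularParametrizationData W' N')
    (hord : GoodOrd W' 3) (hsurj : W'.HasSurjectiveModNGaloisRep 3)
    (hfull : ∀ u : Module.End ℤ_[3] ((W'.baseChange K).tateModule 3), IsUnit u →
      u ∈ Set.range (galoisRepTate (W'.baseChange K) 3))
    (hK : IsImaginaryQuadratic K) (hH : SatisfiesHeegnerHypothesis N' K)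
    (hodd : Odd (NumberField.discr K))
    (κ : ZpExtension K 3) (hκ : κ.IsAnticyclotomic) (γ : absoluteGaloisGroup K)
    [hγ : Fact (κ.IsTopGenerator γ)]
    (𝔭 : HeightOneSpectrum (𝓞 K)) (h𝔭 : ((3 : ℕ) : 𝓞 K) ∈ 𝔭.asIdeal)
    (he : 𝔭.asIdeal.ramificationIdx (𝓞 ℚ) = 1) (hf : 𝔭.asIdeal.inertiaDeg (𝓞 ℚ) = 1)
    (𝔭' : HeightOneSpectrum (𝓞 K)) (h𝔭' : ((3 : ℕ) : 𝓞 K) ∈ 𝔭'.asIdeal) (hne : 𝔭' ≠ 𝔭)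
    (ι' : PadicAlgCl 3 ≃+* ℂ) (hι' : BranchInducesPrime 3 ι' 𝔭) :
    (∃ (ΩK : ℂ) (Ωp : ℂ_[3]) (L' : UnrSeries 3), ΩK ≠ 0 ∧ Ωp ≠ 0 ∧
        IsBDPLFunction ι' 𝔭 κ γ Dt'.f ΩK Ωp L') ∧
      (∀ (ΩK : ℂ) (Ωp : ℂ_[3]) (L' : UnrSeries 3), ΩK ≠ 0 → Ωp ≠ 0 →
        IsBDPLFunction ι' 𝔭 κ γ Dt'.f ΩK Ωp L' →
        (AcSelmer.XAc.charIdeal (W'.baseChange K) 3 κ 𝔭' ∅ γ).map (PowerSeries.map (toUnr 3)) =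
          Ideal.span {L'}) := by
  obtain ⟨ΩK, Ωp, L, hΩK, hL, -, heq⟩ := exists_frame_charIdeal_eq_of_goodOrd_of_fullImage h57 W' N' K
    Dt' hord hsurj hfull hK hH hodd κ hκ γ 𝔭 h𝔭 he hf 𝔭' h𝔭' hne ι' hι'
  have hΩp : ((Ωp : unrIntegers 3) : ℂ_[3]) ≠ 0 := by
    intro h0
    have h1 := norm_coe_units_unrIntegers 3 Ωp
    rw [h0, norm_zero] at h1
    exact zero_ne_one h1
  exact ⟨⟨ΩK, _, L, hΩK, hΩp, hL⟩,
    forall_frame_eq_span_of_exists hK hκ hγ.out ⟨ΩK, _, L, hΩK, hΩp, hL, heq⟩⟩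

/-- **Without the full-image hypothesis: clause (ii) RATIONALLY at EVERY frame** (Yan–Zhu 5.7 (1),
rational clause, at `p = 3`): for a good-ordinary twin with `ρ̄₃` onto over `ℚ` and `K` with `D_K` odd,
every frame `(Ω_K ≠ 0, Ω_p ≠ 0, L′)` has `3^k · L′ ∈ Ch·R₀⟦T⟧` and `3^{k′} · Ch·R₀⟦T⟧ ⊆ (L′)` for some
`k, k′` (and `X_ac` is `Λ`-torsion): the integral obstruction left on bucket A is a power of `3` only.
CONDITIONAL on the named fact `h57`.
[cite: YanZhu2024MainConjNonCM, Thm. 5.7 (1) (§5.2, arXiv:2412.20078v4 l.1217–1227; J. Algebra 693 (2026))] -/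
theorem forall_frame_charIdeal_eq_rat_of_goodOrd
    (h57 : YanZhu2026.thm57_isTorsion_charIdealXGr_eq_bdpLFunction)
    (W' : WeierstrassCurve ℚ) [W'.IsElliptic] [W'.IsGloballyMinimal] (N' : ℕ) [NeZero N']
    (K : Type) [Field K] [NumberField K] (Dt' : ModularParametrizationData W' N')
    (hord : GoodOrd W' 3) (hsurj : W'.HasSurjectiveModNGaloisRep 3)
    (hK : IsImaginaryQuadratic K) (hH : SatisfiesHeegnerHypothesis N' K)
    (hodd : Odd (NumberField.discr K))
    (κ : ZpExtension K 3) (hκ : κ.IsAnticyclotomic) (γ : absoluteGaloisGroup K)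
    [hγ : Fact (κ.IsTopGenerator γ)]
    (𝔭 : HeightOneSpectrum (𝓞 K)) (h𝔭 : ((3 : ℕ) : 𝓞 K) ∈ 𝔭.asIdeal)
    (he : 𝔭.asIdeal.ramificationIdx (𝓞 ℚ) = 1) (hf : 𝔭.asIdeal.inertiaDeg (𝓞 ℚ) = 1)
    (𝔭' : HeightOneSpectrum (𝓞 K)) (h𝔭' : ((3 : ℕ) : 𝓞 K) ∈ 𝔭'.asIdeal) (hne : 𝔭' ≠ 𝔭)
    (ι' : PadicAlgCl 3 ≃+* ℂ) (hι' : BranchInducesPrime 3 ι' 𝔭) :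
    Module.IsTorsion (IwasawaAlgebra 3) (AcSelmer.XAc (W'.baseChange K) 3 κ 𝔭' ∅ γ) ∧
      ∀ (ΩK : ℂ) (Ωp : ℂ_[3]) (L' : UnrSeries 3), ΩK ≠ 0 → Ωp ≠ 0 →
        IsBDPLFunction ι' 𝔭 κ γ Dt'.f ΩK Ωp L' →
        (∃ k : ℕ, PowerSeries.C (((3 : ℕ) : unrIntegers 3) ^ k) * L' ∈
            (AcSelmer.XAc.charIdeal (W'.baseChange K) 3 κ 𝔭' ∅ γ).map (PowerSeries.map (toUnr 3))) ∧
          (∃ k : ℕ, ∀ G ∈ (AcSelmer.XAc.charIdeal (W'.baseChange K) 3 κ 𝔭' ∅ γ).map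
              (PowerSeries.map (toUnr 3)), PowerSeries.C (((3 : ℕ) : unrIntegers 3) ^ k) * G ∈
                Ideal.span {L'}) := by
  have h2 : Module.finrank ℚ K = 2 := hK.1
  have hspl : ((Ideal.span {((3 : ℕ) : ℤ)}).primesOver (𝓞 K)).ncard = 2 :=
    ncard_primesOver_eq_two_of_degreeOne h2 h𝔭 he hf
  have hirrK : (W'.baseChange K).HasIrreducibleModPGaloisRep 3 := irrK_of_surj W' 3 hsurj K h2
  have hd3 : NumberField.discr K ≠ -3 := by
    have hnd : ¬ ((3 : ℕ) : ℤ) ∣ NumberField.discr K :=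
      not_dvd_discr_of_ncard_primesOver Nat.prime_three (hspl.trans h2.symm)
    intro h
    exact hnd ⟨-1, by rw [h]; norm_num⟩
  obtain ⟨ΩK₀, Ωp₀, L₀, hΩK₀, hL₀, htors, hdiv⟩ :=
    h57 ι' W' K 𝔭 𝔭' κ γ Dt'.isNewformOf le_rfl hord hirrK hK hH hspl hodd hd3 hι' h𝔭' hne hκ
  refine ⟨htors, fun ΩK Ωp L' hΩK hΩp hL' ↦ ?_⟩
  obtain ⟨⟨k, hk⟩, ⟨k', hk'⟩⟩ := (hdiv (toUnr 3) (coe_toUnr 3)).1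
  have hΩp₀ : ((Ωp₀ : unrIntegers 3) : ℂ_[3]) ≠ 0 := by
    intro h0
    have h1 := norm_coe_units_unrIntegers 3 Ωp₀
    rw [h0, norm_zero] at h1
    exact zero_ne_one h1
  -- the two frames generate the same ideal
  have hspan : Ideal.span ({L'} : Set (UnrSeries 3)) = Ideal.span {L₀} :=
    span_singleton_eq_of_isBDPLFunction hK hκ hγ.out hΩK₀ hΩK hΩp₀ hΩp hL₀ hL'
  have hbr := xac_charIdeal_eq_literature (W'.baseChange K) 3 κ 𝔭' ∅ γ
  refine ⟨⟨k, ?_⟩, ⟨k', fun G hG ↦ ?_⟩⟩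
  · -- `L' ∈ (L₀)`, so `3^k L' ∈ 3^k (L₀) ⊆ Ch·R₀⟦T⟧`
    have hmem : L' ∈ Ideal.span ({L₀} : Set (UnrSeries 3)) := by
      rw [← hspan]; exact Ideal.mem_span_singleton_self L'
    obtain ⟨u, hu⟩ := Ideal.mem_span_singleton'.mp hmem
    rw [hbr, ← hu, mul_left_comm]
    exact Ideal.mul_mem_left _ u hk
  · rw [hspan]
    rw [hbr] at hG
    exact hk' G hG

end Summit.BirchSwinnertonDyer.BirchSwinnertonDyer.Theorems.UniversalToricDescentTwinSplit

end
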